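import Summits.CriticalPhenomena.PercolationContinuityZ3.Theorems.PercNearOneGluingNoHeavyLowerTailThreePointPivotalBHK
import Summits.CriticalPhenomena.PercolationContinuityZ3.Theorems.PercNearOneGluingNoHeavyLowerTailThreePointDiamondAnyEdge
import HarnessLib

/-!
# The upper diamond: `μ(a|b|c)·μ(abc) − μ(ac|b)·μ(bc|a) ≤ μ(a|b|c) · μ(abc ∧ a ↔ b off the star of c)`

Support file for crux `stmt-CriticalPhenomena-4575` (`NoHeavyLowerTail`), seat `prim-l12-p1` gen 23 (`--supports`); memo
`run/shared/lean/prim/prim-l12/FROM-prim-l12-p1-g23-COV-BOUNDARY.md` §2.  Bond percolation `μ = prodBernoulli w` with arbitrary pair weights on a finite vertex type,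
distinct `a, b, c`; write `x = μ(abc)`, `t = μ(ac|b)`, `u = μ(bc|a)`, `q = μ(a|b|c)` and split `x = x_D + x_N` according to whether `a ↔ b` still holds once the pairs at
`c` are removed (`x_D`) or not (`x_N`: `c` is pivotal for `a ↔ b`).  The tree has the lower diamond `t·u ≤ x·q` (`Consts.threePointDiamond_holds`,
`ThreePointDiamondAnyEdge.diamond_all`) and the pivotality law `q·x_N ≤ t·u` (`ThreePointPivotalBHK.sep_mul_pivotal_le`, van den Berg–Häggström–Kahn Thm. 1.4).
Subtracting: **`0 ≤ x·q − t·u ≤ q·x_D`** (`threePointGap_le_sep_mul_offStar`) — the gap of Gladkov's Conjecture 10.1 (`Consts.ThreePointGapContinuity`) is at most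
`μ(a|b|c)` times the probability that `a, b, c` are all joined AND `a ↔ b` avoiding the star of `c`.  (This bound alone does not prove the conjecture: `q·x_D` need not be
small when `μ(ab|c)` is small, see the memo §2; the companion file `…ThreePointCovBoundary` gives the boundary-weight bound.)  No definitions, no sorries, standard axioms.
-/

namespace Summit.CriticalPhenomena.PercolationContinuityZ3.Theorems.ThreePointGapUpperDiamond

open MeasureTheory Set
open Literature.Probability.Percolation Literature.Probability.LatticeModels
open scoped Classical

variable {V : Type*} [Fintype V] [DecidableEq V]

/-- On `{a ↔ b but not off the star of c}` all three vertices are joined: `(a↔b) ∩ N ⊆ abc`, so `abc ∩ N = (a↔b) ∩ N`. [this work] -/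
theorem all_inter_pivotal_eq (a b c : V) :
    (openConn a b ∩ openConn a c ∩ openConn b c ∩
        {ω : BondConfig V | ¬ (openGraph (ω \ ↑(Finset.univ.filter fun e : Sym2 V => c ∈ e))).Reachable a b} : Set (BondConfig V)) =
      openConn a b ∩ {ω : BondConfig V | ¬ (openGraph (ω \ ↑(Finset.univ.filter fun e : Sym2 V => c ∈ e))).Reachable a b} := by
  ext ω
  simp only [mem_inter_iff, openConn, mem_setOf_eq]
  constructor
  · rintro ⟨⟨⟨hab, -⟩, -⟩, hN⟩; exact ⟨hab, hN⟩
  · rintro ⟨hab, hN⟩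
    have hac := ThreePointPivotalBHK.reachable_h_of_pivotal (h := c) hab hN
    have hN' : ¬ (openGraph (ω \ ↑(Finset.univ.filter fun e : Sym2 V => c ∈ e))).Reachable b a := fun h => hN h.symm
    have hbc := ThreePointPivotalBHK.reachable_h_of_pivotal (h := c) hab.symm hN'
    exact ⟨⟨⟨hab, hac⟩, hbc⟩, hN⟩

/-- **The upper diamond** (distinct `a, b, c`): `μ(a|b|c)·μ(abc) − μ(ac|b)·μ(bc|a) ≤ μ(a|b|c) · μ(abc ∧ a ↔ b off the star of c)`.
From `q·x_N ≤ t·u` (`ThreePointPivotalBHK.sep_mul_pivotal_le`, BHK 2006 Thm. 1.4) and `x = x_D + x_N`.  Together with the lower diamond `t·u ≤ q·x`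
(`Consts.threePointDiamond_holds`): `q·x_N ≤ t·u ≤ q·x`. [cite: VandenbergHaggstromKahn2005, Thm. 1.4] [cite: Gladkov2024, Conjecture 10.1 (§10)] [this work] -/
theorem threePointGap_le_sep_mul_offStar (w : Sym2 V → unitInterval) {a b c : V} (hab : a ≠ b) (hac : a ≠ c) (hbc : b ≠ c) :
    (prodBernoulli w).real ((openConn a b)ᶜ ∩ (openConn a c)ᶜ ∩ (openConn b c)ᶜ) *
          (prodBernoulli w).real (openConn a b ∩ openConn a c ∩ openConn b c) -
        (prodBernoulli w).real (openConn a c ∩ (openConn a b)ᶜ) * (prodBernoulli w).real (openConn b c ∩ (openConn a b)ᶜ) ≤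
      (prodBernoulli w).real ((openConn a b)ᶜ ∩ (openConn a c)ᶜ ∩ (openConn b c)ᶜ) *
        (prodBernoulli w).real (openConn a b ∩ openConn a c ∩ openConn b c ∩
          {ω : BondConfig V | (openGraph (ω \ ↑(Finset.univ.filter fun e : Sym2 V => c ∈ e))).Reachable a b}) := by
  set μ := prodBernoulli w with hμ
  set N : Set (BondConfig V) := {ω | ¬ (openGraph (ω \ ↑(Finset.univ.filter fun e : Sym2 V => c ∈ e))).Reachable a b} with hN
  have hpiv := ThreePointPivotalBHK.sep_mul_pivotal_le w hab hac hbc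
  -- `x = x_D + x_N` with `x_N = μ((a↔b) ∩ N)`
  have hsplit : μ.real (openConn a b ∩ openConn a c ∩ openConn b c ∩ N) +
      μ.real ((openConn a b ∩ openConn a c ∩ openConn b c) \ N) = μ.real (openConn a b ∩ openConn a c ∩ openConn b c) :=
    measureReal_inter_add_sdiff MeasurableSet.of_discrete
  have hD : ((openConn a b ∩ openConn a c ∩ openConn b c) \ N : Set (BondConfig V)) =
      openConn a b ∩ openConn a c ∩ openConn b c ∩
        {ω : BondConfig V | (openGraph (ω \ ↑(Finset.univ.filter fun e : Sym2 V => c ∈ e))).Reachable a b} := by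
    ext ω; simp [hN]
  rw [all_inter_pivotal_eq a b c, hD] at hsplit
  change μ.real ((openConn a b)ᶜ ∩ (openConn a c)ᶜ ∩ (openConn b c)ᶜ) * μ.real (openConn a b ∩ N) ≤
    μ.real (openConn a c ∩ (openConn a b)ᶜ) * μ.real (openConn b c ∩ (openConn a b)ᶜ) at hpiv
  have hq : 0 ≤ μ.real ((openConn a b)ᶜ ∩ (openConn a c)ᶜ ∩ (openConn b c)ᶜ) := measureReal_nonneg
  nlinarith [hpiv, hsplit, hq]

/-- **The diamond sandwich**, cell form (distinct `a, b, c`): `q·x_N ≤ t·u ≤ q·x`, i.e. `0 ≤ x·q − t·u ≤ q·x_D` where `x_D = μ(abc ∧ a↔b off the star of c)`;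
the lower half is `Consts.threePointDiamond_holds`, restated here with the same event shapes for convenience.
[cite: VandenbergHaggstromKahn2005, Thm. 1.4] [cite: Gladkov2024, Conjecture 10.1 (§10)] [this work] -/
theorem threePointGap_sandwich (w : Sym2 V → unitInterval) {a b c : V} (hab : a ≠ b) (hac : a ≠ c) (hbc : b ≠ c) :
    0 ≤ (prodBernoulli w).real ((openConn a b)ᶜ ∩ (openConn a c)ᶜ ∩ (openConn b c)ᶜ) *
          (prodBernoulli w).real (openConn a b ∩ openConn a c ∩ openConn b c) -
        (prodBernoulli w).real (openConn a c ∩ (openConn a b)ᶜ) * (prodBernoulli w).real (openConn b c ∩ (openConn a b)ᶜ) ∧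
    (prodBernoulli w).real ((openConn a b)ᶜ ∩ (openConn a c)ᶜ ∩ (openConn b c)ᶜ) *
          (prodBernoulli w).real (openConn a b ∩ openConn a c ∩ openConn b c) -
        (prodBernoulli w).real (openConn a c ∩ (openConn a b)ᶜ) * (prodBernoulli w).real (openConn b c ∩ (openConn a b)ᶜ) ≤
      (prodBernoulli w).real ((openConn a b)ᶜ ∩ (openConn a c)ᶜ ∩ (openConn b c)ᶜ) *
        (prodBernoulli w).real (openConn a b ∩ openConn a c ∩ openConn b c ∩
          {ω : BondConfig V | (openGraph (ω \ ↑(Finset.univ.filter fun e : Sym2 V => c ∈ e))).Reachable a b}) := by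
  refine ⟨?_, threePointGap_le_sep_mul_offStar w hab hac hbc⟩
  have h := ThreePointDiamondAnyEdge.diamond_cells w a b c
  have eT : (openConn a c ∩ (openConn a b)ᶜ : Set (BondConfig V)) = openConn a c ∩ (openConn b c)ᶜ := by
    ext ω; simp only [mem_inter_iff, mem_compl_iff, openConn, mem_setOf_eq]
    constructor
    · rintro ⟨hac', nab⟩; exact ⟨hac', fun hbc' => nab (hac'.trans hbc'.symm)⟩
    · rintro ⟨hac', nbc⟩; exact ⟨hac', fun hab' => nbc (hab'.symm.trans hac')⟩
  have eU : (openConn b c ∩ (openConn a b)ᶜ : Set (BondConfig V)) = openConn b c ∩ (openConn a c)ᶜ := by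
    ext ω; simp only [mem_inter_iff, mem_compl_iff, openConn, mem_setOf_eq]
    constructor
    · rintro ⟨hbc', nab⟩; exact ⟨hbc', fun hac' => nab (hac'.trans hbc'.symm)⟩
    · rintro ⟨hbc', nac⟩; exact ⟨hbc', fun hab' => nac (hab'.trans hbc')⟩
  have eX : (openConn a b ∩ openConn a c ∩ openConn b c : Set (BondConfig V)) = openConn a c ∩ openConn b c := by
    ext ω; simp only [mem_inter_iff, openConn, mem_setOf_eq]
    constructor
    · rintro ⟨⟨-, hac'⟩, hbc'⟩; exact ⟨hac', hbc'⟩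
    · rintro ⟨hac', hbc'⟩; exact ⟨⟨hac'.trans hbc'.symm, hac'⟩, hbc'⟩
  rw [eT, eU, eX]
  linarith

end Summit.CriticalPhenomena.PercolationContinuityZ3.Theorems.ThreePointGapUpperDiamond
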